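import Literature.NumberTheory.Rogawski1990.UnitaryGroupGeometricPoints
import Mathlib.FieldTheory.IsAlgClosed.AlgebraicClosure
import Mathlib.FieldTheory.Galois.Infinite
import Mathlib.FieldTheory.Normal.Basic
import Mathlib.NumberTheory.NumberField.CMField
import HarnessLib

/-!
# The `F̄`-points model of `U(H)` for a CM field: `Γ = Gal(L̄/L⁺)` acting on `GL_n(L̄)`, fixed points `= U(H)(L⁺)`
# (Rogawski 1990, §1.9, §3.1) — the instance of ★ `UnitaryGroupGeometricPoints` used by the floor-0 ENGINE (`cmDatum`)

Topic `NumberTheory/Rogawski1990`; namespace `Literature.NumberTheory.Rogawski1990`.  DEFINITIONS WITH BODIES + theorems; no named fact,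
no `sorry`, no instance, no notation.  For a CM number field `L` (`L⁺ = maximalRealSubfield L`, conjugation ★ `cmConjRingHom L`) we take
`K = L̄ := AlgebraicClosure L` and `Γ := L̄ ≃ₐ[L⁺] L̄ = Gal(L̄/L⁺)` and build the twist datum ★ `CMTwist` of `UnitaryGroupGeometricPoints`:
`emb = algebraMap L L̄`, `conj = cmConjRingHom L`, `sign = cmSign L : Gal(L̄/L⁺) →* ℤˣ` (restriction to the normal subextension
`L/L⁺`, whose Galois group is `{1, complexConj}` — Mathlib `IsCMField.zpowers_complexConj_eq_top`).  We DISCHARGE the three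
hypotheses of ★ `forall_twistedAct_eq_iff`: `emb` injective; `hfix` = «`L̄^{Gal(L̄/L)} = L`» (Mathlib `InfiniteGalois.
mem_range_algebraMap_iff_fixed`, `L̄/L` Galois in characteristic `0`); `hc` = complex conjugation extends to `L̄` (Mathlib
`AlgEquiv.restrictNormalHom_surjective`).  RESULT: for a hermitian `H ∈ GL_n(L)`, **`(GL_n(L̄))^{Gal(L̄/L⁺)} = U(H)(L⁺) =
unitaryGroup (cmConjRingHom L) H = (UnitaryGroup.cmDatum L n H).Rational`** for the twisted action (`forall_twistedAct_cm_eq_iff`,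
`mem_fixedPoints_cmTwistedAction_iff`) — the `Γ`-group `A = G(F̄)` of ★ `GaloisCohomology/NonAbelianH1StableClasses` for the
engine's inner form `G = U(H)`, [Rogawski1990, §3.1 p. 19: «`δ = g⁻¹γg`, `g ∈ G(F̄)`»; §1.9: «over `E`, `G` is isomorphic to … `D^*`»].
-/

noncomputable section

namespace Literature.NumberTheory.Rogawski1990

open scoped MatrixGroups Matrix
open NumberField
open Literature.AlgebraicGeometry.ShimuraVarieties (unitaryGroup)
open Literature.NumberTheory.Automorphic (cmConjRingHom cmConjRingHom_apply)

variable (L : Type*) [Field L] [NumberField L] [IsCMField L]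

/-! ## §1 `Gal(L/L⁺) = {1, c}` and the sign `Gal(L̄/L⁺) →* ℤˣ` -/

/-- Every `L⁺`-automorphism of the CM field `L` is `1` or the complex conjugation. [cite: Rogawski1990, §1.9] -/
theorem algEquiv_eq_one_or_eq_complexConj (σ : L ≃ₐ[maximalRealSubfield L] L) : σ = 1 ∨ σ = IsCMField.complexConj L := by
  have hσ : σ ∈ Subgroup.zpowers (IsCMField.complexConj L) := by
    rw [IsCMField.zpowers_complexConj_eq_top]; exact Subgroup.mem_top σ
  obtain ⟨k, rfl⟩ := Subgroup.mem_zpowers_iff.mp hσ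
  rcases Int.even_or_odd k with ⟨m, rfl⟩ | ⟨m, rfl⟩
  · left
    rw [← two_mul, zpow_mul, zpow_ofNat, ← IsCMField.orderOf_complexConj L, pow_orderOf_eq_one, one_zpow]
  · right
    rw [zpow_add, zpow_one, zpow_mul, zpow_ofNat, ← IsCMField.orderOf_complexConj L, pow_orderOf_eq_one, one_zpow, one_mul]

/-- The sign of an `L⁺`-automorphism of `L`: `1 ↦ 1`, `c ↦ -1`. [cite: Rogawski1990, §1.9] -/
def galSignL (σ : L ≃ₐ[maximalRealSubfield L] L) : ℤˣ := by
  classical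
  exact if σ = 1 then 1 else -1

omit [NumberField L] [IsCMField L] in
/-- `galSignL 1 = 1`. [cite: Rogawski1990, §1.9] -/
theorem galSignL_one : galSignL L 1 = 1 := by simp [galSignL]

/-- `galSignL c = -1`. [cite: Rogawski1990, §1.9] -/
theorem galSignL_complexConj : galSignL L (IsCMField.complexConj L) = -1 := by
  simp [galSignL, IsCMField.complexConj_ne_one]

/-- `galSignL σ = 1 ↔ σ = 1`. [cite: Rogawski1990, §1.9] -/
theorem galSignL_eq_one_iff (σ : L ≃ₐ[maximalRealSubfield L] L) : galSignL L σ = 1 ↔ σ = 1 := by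
  rcases algEquiv_eq_one_or_eq_complexConj L σ with rfl | rfl
  · simp [galSignL_one]
  · simp only [galSignL_complexConj, IsCMField.complexConj_ne_one, iff_false]; decide

/-- The sign `Gal(L/L⁺) →* ℤˣ` as a group homomorphism (an isomorphism onto `ℤˣ`). [cite: Rogawski1990, §1.9] -/
def galSignLHom : (L ≃ₐ[maximalRealSubfield L] L) →* ℤˣ where
  toFun := galSignL L
  map_one' := galSignL_one L
  map_mul' σ τ := by
    rcases algEquiv_eq_one_or_eq_complexConj L σ with rfl | rfl <;>
      rcases algEquiv_eq_one_or_eq_complexConj L τ with rfl | rfl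
    · rw [one_mul, galSignL_one, one_mul]
    · rw [one_mul, galSignL_one, one_mul]
    · rw [mul_one, galSignL_one, mul_one]
    · have h2 : IsCMField.complexConj L * IsCMField.complexConj L = 1 := by
        rw [← pow_two, ← IsCMField.orderOf_complexConj L, pow_orderOf_eq_one]
      rw [h2, galSignL_one, galSignL_complexConj]; decide

/-- **`cmSign : Gal(L̄/L⁺) →* ℤˣ`**, the restriction to `L` followed by the sign. [cite: Rogawski1990, §1.9] -/
def cmSign : (AlgebraicClosure L ≃ₐ[maximalRealSubfield L] AlgebraicClosure L) →* ℤˣ :=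
  (galSignLHom L).comp (AlgEquiv.restrictNormalHom L)

/-- `cmSign τ = 1 ↔ τ` restricts to the identity of `L`. [cite: Rogawski1990, §1.9] -/
theorem cmSign_eq_one_iff (τ : AlgebraicClosure L ≃ₐ[maximalRealSubfield L] AlgebraicClosure L) :
    cmSign L τ = 1 ↔ AlgEquiv.restrictNormalHom L τ = 1 :=
  galSignL_eq_one_iff L _

/-- `cmSign τ = -1 ↔ τ` restricts to the complex conjugation of `L`. [cite: Rogawski1990, §1.9] -/
theorem cmSign_eq_neg_one_iff (τ : AlgebraicClosure L ≃ₐ[maximalRealSubfield L] AlgebraicClosure L) :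
    cmSign L τ = -1 ↔ AlgEquiv.restrictNormalHom L τ = IsCMField.complexConj L := by
  rcases algEquiv_eq_one_or_eq_complexConj L (AlgEquiv.restrictNormalHom L τ) with h | h
  · rw [cmSign, MonoidHom.comp_apply, h]
    change galSignL L 1 = -1 ↔ _
    rw [galSignL_one]
    simp only [(IsCMField.complexConj_ne_one L).symm, iff_false]; decide
  · rw [cmSign, MonoidHom.comp_apply, h]
    change galSignL L (IsCMField.complexConj L) = -1 ↔ _
    rw [galSignL_complexConj]; simp

/-! ## §2 The twist datum of a CM field through `L̄` -/

/-- **The CM twist datum** `(emb = L → L̄, conj = cmConjRingHom L, sign = cmSign L)` for `Γ = Gal(L̄/L⁺)` acting on `L̄`.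
[cite: Rogawski1990, §1.9] -/
def cmTwist : CMTwist (AlgebraicClosure L) (AlgebraicClosure L ≃ₐ[maximalRealSubfield L] AlgebraicClosure L) L where
  emb := algebraMap L (AlgebraicClosure L)
  conj := cmConjRingHom L
  sign := cmSign L
  smul_emb_of_sign_eq_one τ hτ x := by
    rw [cmSign_eq_one_iff] at hτ
    rw [AlgEquiv.smul_def, ← AlgEquiv.restrictNormal_commutes]
    change algebraMap L (AlgebraicClosure L) (AlgEquiv.restrictNormalHom L τ x) = _
    rw [hτ, AlgEquiv.one_apply]
  smul_emb_of_sign_eq_neg_one τ hτ x := by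
    rw [cmSign_eq_neg_one_iff] at hτ
    rw [AlgEquiv.smul_def, ← AlgEquiv.restrictNormal_commutes, cmConjRingHom_apply]
    change algebraMap L (AlgebraicClosure L) (AlgEquiv.restrictNormalHom L τ x) = _
    rw [hτ]

/-- `(cmTwist L).emb = algebraMap L L̄` is injective. [cite: Rogawski1990, §1.9] -/
theorem cmTwist_emb_injective : Function.Injective (cmTwist L).emb := (algebraMap L (AlgebraicClosure L)).injective

/-- **`L̄^{Gal(L̄/L)} = L`** in the form `hfix` of ★ `forall_twistedAct_eq_iff`: an element of `L̄` fixed by every `τ ∈ Gal(L̄/L⁺)` with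
`cmSign τ = 1` lies in `L` (Galois theory of `L̄/L`, Mathlib `InfiniteGalois.mem_range_algebraMap_iff_fixed`). [cite: Rogawski1990, §1.9] -/
theorem cmTwist_hfix (x : AlgebraicClosure L)
    (hx : ∀ τ : AlgebraicClosure L ≃ₐ[maximalRealSubfield L] AlgebraicClosure L, (cmTwist L).sign τ = 1 → τ • x = x) :
    x ∈ Set.range (cmTwist L).emb := by
  change x ∈ Set.range (algebraMap L (AlgebraicClosure L))
  rw [InfiniteGalois.mem_range_algebraMap_iff_fixed]
  intro f
  -- `f ∈ Gal(L̄/L)` is `L⁺`-linear and restricts to the identity of `L`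
  let τ : AlgebraicClosure L ≃ₐ[maximalRealSubfield L] AlgebraicClosure L := f.restrictScalars (maximalRealSubfield L)
  have hτ : (cmTwist L).sign τ = 1 := by
    change cmSign L τ = 1
    rw [cmSign_eq_one_iff]
    ext y
    apply (algebraMap L (AlgebraicClosure L)).injective
    change algebraMap L (AlgebraicClosure L) ((τ.restrictNormal L) y) =
      algebraMap L (AlgebraicClosure L) ((1 : L ≃ₐ[maximalRealSubfield L] L) y)
    rw [AlgEquiv.restrictNormal_commutes, AlgEquiv.one_apply]
    exact f.commutes y
  have := hx τ hτ
  rwa [AlgEquiv.smul_def] at this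

/-- **Complex conjugation extends to `L̄`**: some `τ ∈ Gal(L̄/L⁺)` has `cmSign τ = -1` (Mathlib `AlgEquiv.restrictNormalHom_surjective`,
`L̄` normal over `L⁺`). [cite: Rogawski1990, §1.9] -/
theorem cmTwist_hc : ∃ τ : AlgebraicClosure L ≃ₐ[maximalRealSubfield L] AlgebraicClosure L, (cmTwist L).sign τ = -1 := by
  obtain ⟨τ, hτ⟩ := AlgEquiv.restrictNormalHom_surjective (E := AlgebraicClosure L) (IsCMField.complexConj L)
  exact ⟨τ, (cmSign_eq_neg_one_iff L τ).mpr hτ⟩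

/-! ## §3 `(GL_n(L̄))^{Gal(L̄/L⁺)} = U(H)(L⁺)` -/

variable {N : ℕ} (H : GL (Fin N) L) (hH : ((H : Matrix (Fin N) (Fin N) L).map (cmConjRingHom L))ᵀ = (H : Matrix (Fin N) (Fin N) L))

/-- **The fixed points of the twisted `Gal(L̄/L⁺)`-action on `GL_N(L̄)` are exactly (the images of) `U(H)(L⁺) = unitaryGroup
(cmConjRingHom L) H`** — the rational points `(UnitaryGroup.cmDatum L N H).Rational` of the ENGINE's inner form `G′ = U(H)`, inside
its `F̄`-points `G′(F̄) = GL_N(L̄)`. [cite: Rogawski1990, §3.1 p. 19] -/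
theorem forall_twistedAct_cm_eq_iff (g : GL (Fin N) (AlgebraicClosure L)) :
    (∀ τ : AlgebraicClosure L ≃ₐ[maximalRealSubfield L] AlgebraicClosure L, twistedAct (cmTwist L) H τ g = g) ↔
      ∃ g₀ : GL (Fin N) L, g₀ ∈ unitaryGroup (cmConjRingHom L) (H : Matrix (Fin N) (Fin N) L) ∧ (cmTwist L).embGL g₀ = g :=
  forall_twistedAct_eq_iff (cmTwist L) H (cmTwist_emb_injective L) (cmTwist_hfix L) (cmTwist_hc L) g

include hH in
/-- The same for the `MulDistribMulAction` `twistedAction (cmTwist L) H hH` (hermitian `H`): `(GL_N(L̄))^Γ` = image of `U(H)(L⁺)`.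
[cite: Rogawski1990, §3.1 p. 19] -/
theorem mem_fixedPoints_cmTwistedAction_iff (g : GL (Fin N) (AlgebraicClosure L)) :
    (letI := twistedAction (cmTwist L) H hH;
      g ∈ FixedPoints.subgroup (AlgebraicClosure L ≃ₐ[maximalRealSubfield L] AlgebraicClosure L) (GL (Fin N) (AlgebraicClosure L))) ↔
      ∃ g₀ : GL (Fin N) L, g₀ ∈ unitaryGroup (cmConjRingHom L) (H : Matrix (Fin N) (Fin N) L) ∧ (cmTwist L).embGL g₀ = g :=
  mem_fixedPoints_twistedAction_iff (cmTwist L) H (cmTwist_emb_injective L) (cmTwist_hfix L) (cmTwist_hc L) hH g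

/-- Every element of `U(H)(L⁺)` is a fixed point (no hermitian hypothesis needed for this direction). [cite: Rogawski1990, §3.1 p. 19] -/
theorem twistedAct_cm_embGL (g₀ : unitaryGroup (cmConjRingHom L) (H : Matrix (Fin N) (Fin N) L))
    (τ : AlgebraicClosure L ≃ₐ[maximalRealSubfield L] AlgebraicClosure L) :
    twistedAct (cmTwist L) H τ ((cmTwist L).embGL g₀) = (cmTwist L).embGL g₀ :=
  twistedAct_embGL_of_mem_unitaryGroup (cmTwist L) H g₀.2 τ

/-- **Stable conjugacy in `U(H)(L⁺)` is conjugacy in the `Γ`-group `A = GL_N(L̄)`**: ★ `IsStablyConj` (= `GL_N(L)`-conjugacy) iff the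
images under `embGL = GL_N(algebraMap L L̄)` are conjugate (★ `isStablyConj_iff_isConj_map` at `K = L̄`) — so ★ `invClass` ∕ `kerH1` of
`GaloisCohomology/NonAbelianH1StableClasses` apply to `A = GL_N(L̄)` with `twistedAction (cmTwist L) H hH`. [cite: Rogawski1990, §3.1 p. 19] -/
theorem isStablyConj_cm_iff_isConj_embGL (γ δ : unitaryGroup (cmConjRingHom L) (H : Matrix (Fin N) (Fin N) L)) :
    IsStablyConj (cmConjRingHom L) (H : Matrix (Fin N) (Fin N) L) γ δ ↔
      IsConj ((cmTwist L).embGL (γ : GL (Fin N) L)) ((cmTwist L).embGL (δ : GL (Fin N) L)) :=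
  isStablyConj_iff_isConj_map (AlgebraicClosure L) γ δ

end Literature.NumberTheory.Rogawski1990
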